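import Summits.ABC.IUTFork.Conditional.AbcOfSHregCutMixedWitnessSUnit
import HarnessLib

/-!
# `hregC` (the CONTENT-cut cone binder of the certificate of record K, C-R47) on the S-unit family: decided both ways by the
# discriminant of `ℚ(√(5^{2a} + 4·7^{2c}))` (plan RULING C-R42 «C:SZPIRO-GUARD-SUNIT», content instance)

Record-only PROOF file (D-0012) of the abc-iut cell (R2 S-chain team, seat abc-iut-s2-p4 gen 5); TAKES NO SIDE on [IUTchIII] Cor. 3.12,
on [IUTchIV] Thm. 1.10, or on any author. S. Mochizuki, *IUT IV* [Mochizuki2012], Thm. 1.10 pp. 22–23 (display, `d*_mod = 2^12·3^3·5·d_mod`),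
proof Steps (v)–(viii) pp. 27–31; Cor. 2.2 (ii) proof p. 46; [MochizukiGenEll2010] Def. 1.5 (iii) p. 8.

Since C-R47 the certificate of record K (`Conditional.abc_of_SH_v10K_window_content`, p460293) and the θ-companion (p459802) demand the
cone estimate only on the CONTENT locus of [IUTchIV] Thm. 1.10's display: antecedent
`6·(1 + 20·d_mod/l)·(log-diff + log-cond) + 120·d*_mod·l < log q^{∤{2,l}}(λ)` (`hregC`). On the S-unit family `P_{a,c}` (parts I–V;
`d_mod = 2`, `log q^{∤{2,l}} = a·log 5 + 2c·log 7 =: Q`, `log-cond = ½(log 5 + 2 log 7)`, `log-diff = ½·log|disc F_{a,c}|`):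
* `SUnitFamily.content_iff_logDiff_lt` / `content_iff_log_discr_lt` — content at `(P_{a,c}, l)` ⟺
  `log|disc ℚ(√(5^{2a}+4·7^{2c}))| < (Q − 120·d*₂·l)/(3(1 + 40/l)) − (log 5 + 2·log 7)` (`d*₂ = 2^12·3^3·5·2 = 1105920`);
* `SUnitFamily.log_discr_lt_of_content` — a content member has `log|disc F_{a,c}| < (l/(l+40))·(a·log 5 − 40·d*₂·l)` (`7^c ≤ 5^a`): squarefree
  kernel of `D` below `√D·D^{−20/(l+40)}` AND `a·log 5 > 40·d*₂·l` (`> 7.6·10⁹` at `l = 173`);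
* `SUnitFamily.content_of_log_discr_le` — `log|disc F_{a,c}| ≤ (l/(l+40))·(a·log 5 − (2/3)·l·log 5 − 40·d*₂·l) − (log 5 + 2 log 7) − 1` makes
  `(P_{a,c}, l)` a content point (`5^a ≤ 5^l·7^c`);
* **`Conditional.not_hregC_of_sUnitFamily_content`** / **`not_hregC_of_sUnitFamily_powerful`** — for a prime `l ≥ 173`: content members (resp.
  members with that small a discriminant) with `a` unbounded ⟹ `hregC` (binder text VERBATIM, p459802/p460293) is FALSE
  (`Conditional.not_hregCut_of_sUnitFamily` with `X` = the content guard);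
* **`Conditional.contentFree_eventually_of_hregC`** / **`lt_log_discr_eventually_of_hregC`** — contrapositives: `hregC` ⟹ NO large member is a
  content point ⟺ `log|disc ℚ(√(5^{2a}+4·7^{2c}))| > (l/(l+40))·(a·log 5 − (2/3)·l·log 5 − 40·d*₂·l) − (log 5 + 2 log 7) − 1` for all large
  `a` (`l ∤ a, c`, `7^c ≤ 5^a ≤ 5^l·7^c`) — an abc-type lower bound on the squarefree kernel of `5^{2a} + 4·7^{2c}` of exponent `½·l/(l+40)`.
HONEST READING: as for `hregBad` (p465518), the record's cone binder restricted to this family is (up to thresholds) an explicit abc-type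
statement about the `ℤ`-triples `5^{2a} + 4·7^{2c} = D`, here with the weaker exponent `½ − 20/(l+40)` and the huge additive constant
`40·d*₂·l` of print's display: neither provable nor refutable in the tree; C-R47's reading («nothing consumed at any known datum») is
untouched — the family's content members, if any, have `a > 4.7·10⁹`. Nothing asserted; no side taken; typed ≠ proved. PROOF-ONLY file.
[cite: Mochizuki2012, IUTchIV Thm. 1.10 p. 22–23] [cite: Mochizuki2012, IUTchIV Thm. 1.10 proof Steps (v)-(viii) p. 27–31]
[cite: MochizukiGenEll2010, Def 1.5 (iii) p.8] [claim: Mochizuki2012, status: disputed] for every IUT quotation.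
-/

noncomputable section

namespace Summit.ABC.IUTFork

open NumberField IsDedekindDomain Literature.IUT.LogVolume Literature.IUT.LogVolume.Cor22 Literature.IUT.HodgeTheaters
open Literature.NumberTheory.DiophantineGeometry.GenEll Literature.NumberTheory.NumberFields
open scoped Classical

namespace SUnitFamily

section Content

variable {a c : ℕ} (ha : 1 ≤ a) (hc : 1 ≤ c) {l : ℕ} (hl : l.Prime) (h11 : 11 ≤ l)
include ha hc hl h11

/-- **THE CONTENT GUARD, EXACTLY.** For a prime `l ≥ 11`, the display-content antecedent of `hregC`
(`6·(1 + 20·d_mod/l)·(log-diff + log-cond) + 120·d*_mod·l < log q^{∤{2,l}}`, VERBATIM) holds at `(P_{a,c}, l)` IFF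
`log-diff(P_{a,c}) < (a·log 5 + 2c·log 7 − 120·(2^12·3^3·5·2·l))/(6·(1 + 40/l)) − ½(log 5 + 2·log 7)`.
[cite: Mochizuki2012, IUTchIV Thm. 1.10 p. 22–23] [claim: Mochizuki2012, status: disputed] -/
theorem content_iff_logDiff_lt :
    6 * ((1 + 20 * (dmod (Pt a c) : ℝ) / l) * ((Pt a c).logDiff + logCondAvoid (Pt a c) {2, l}))
        + 120 * (2 ^ 12 * 3 ^ 3 * 5 * (dmod (Pt a c) : ℝ) * l) < logQAvoid (Pt a c) {2, l} ↔
    (Pt a c).logDiff <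
      ((a : ℝ) * Real.log 5 + 2 * (c : ℝ) * Real.log 7 - 120 * (2 ^ 12 * 3 ^ 3 * 5 * 2 * (l : ℝ))) / (6 * (1 + 40 / (l : ℝ)))
        - (Real.log 5 + 2 * Real.log 7) / 2 := by
  have hl5 : l ≠ 5 := by omega
  have hl7 : l ≠ 7 := by omega
  have hd : (dmod (Pt a c) : ℝ) = 2 := by rw [dmod_P ha hc]; norm_num
  have hQ := logQAvoid_two_l_eq ha hc hl hl5 hl7
  have hC := logCondAvoid_two_l_eq ha hc hl hl5 hl7
  have hlr : (11 : ℝ) ≤ (l : ℝ) := by exact_mod_cast h11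
  have h0 : (l : ℝ) ≠ 0 := by positivity
  have h40 : (l : ℝ) + 40 ≠ 0 := ne_of_gt (by linarith)
  have hB : 0 < 6 * (1 + 40 / (l : ℝ)) := by positivity
  have key : logQAvoid (Pt a c) {2, l} -
        (6 * ((1 + 20 * (dmod (Pt a c) : ℝ) / l) * ((Pt a c).logDiff + logCondAvoid (Pt a c) {2, l}))
          + 120 * (2 ^ 12 * 3 ^ 3 * 5 * (dmod (Pt a c) : ℝ) * l)) =
      6 * (1 + 40 / (l : ℝ)) *
        ((((a : ℝ) * Real.log 5 + 2 * (c : ℝ) * Real.log 7 - 120 * (2 ^ 12 * 3 ^ 3 * 5 * 2 * (l : ℝ))) / (6 * (1 + 40 / (l : ℝ)))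
          - (Real.log 5 + 2 * Real.log 7) / 2) - (Pt a c).logDiff) := by
    rw [hd, hQ, hC]
    field_simp
    ring
  constructor
  · intro h
    have h' : 0 < 6 * (1 + 40 / (l : ℝ)) *
        ((((a : ℝ) * Real.log 5 + 2 * (c : ℝ) * Real.log 7 - 120 * (2 ^ 12 * 3 ^ 3 * 5 * 2 * (l : ℝ))) / (6 * (1 + 40 / (l : ℝ)))
          - (Real.log 5 + 2 * Real.log 7) / 2) - (Pt a c).logDiff) := by
      rw [← key]; linarith
    have := (mul_pos_iff_of_pos_left hB).mp h'
    linarith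
  · intro h
    have h' : 0 < 6 * (1 + 40 / (l : ℝ)) *
        ((((a : ℝ) * Real.log 5 + 2 * (c : ℝ) * Real.log 7 - 120 * (2 ^ 12 * 3 ^ 3 * 5 * 2 * (l : ℝ))) / (6 * (1 + 40 / (l : ℝ)))
          - (Real.log 5 + 2 * Real.log 7) / 2) - (Pt a c).logDiff) := mul_pos hB (by linarith)
    rw [← key] at h'
    linarith

/-- **THE CONTENT GUARD IN TERMS OF THE DISCRIMINANT.** Content at `(P_{a,c}, l)` ⟺
`log|disc ℚ(√(5^{2a}+4·7^{2c}))| < (a·log 5 + 2c·log 7 − 120·d*₂·l)/(3·(1 + 40/l)) − (log 5 + 2·log 7)`, `d*₂ = 2^12·3^3·5·2`.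
[cite: MochizukiGenEll2010, Def 1.5 (iii) p.8] [claim: Mochizuki2012, status: disputed] -/
theorem content_iff_log_discr_lt :
    6 * ((1 + 20 * (dmod (Pt a c) : ℝ) / l) * ((Pt a c).logDiff + logCondAvoid (Pt a c) {2, l}))
        + 120 * (2 ^ 12 * 3 ^ 3 * 5 * (dmod (Pt a c) : ℝ) * l) < logQAvoid (Pt a c) {2, l} ↔
    Real.log ((NumberField.discr (F a c)).natAbs : ℝ) <
      ((a : ℝ) * Real.log 5 + 2 * (c : ℝ) * Real.log 7 - 120 * (2 ^ 12 * 3 ^ 3 * 5 * 2 * (l : ℝ))) / (3 * (1 + 40 / (l : ℝ)))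
        - (Real.log 5 + 2 * Real.log 7) := by
  rw [content_iff_logDiff_lt ha hc hl h11, logDiff_eq_half_log_discr]
  have hlr : (11 : ℝ) ≤ (l : ℝ) := by exact_mod_cast h11
  have h0 : (l : ℝ) ≠ 0 := by positivity
  have h40 : (l : ℝ) + 40 ≠ 0 := ne_of_gt (by linarith)
  have e : ((a : ℝ) * Real.log 5 + 2 * (c : ℝ) * Real.log 7 - 120 * (2 ^ 12 * 3 ^ 3 * 5 * 2 * (l : ℝ))) / (3 * (1 + 40 / (l : ℝ)))
        - (Real.log 5 + 2 * Real.log 7) =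
      2 * (((a : ℝ) * Real.log 5 + 2 * (c : ℝ) * Real.log 7 - 120 * (2 ^ 12 * 3 ^ 3 * 5 * 2 * (l : ℝ))) / (6 * (1 + 40 / (l : ℝ)))
        - (Real.log 5 + 2 * Real.log 7) / 2) := by
    field_simp
    ring
  rw [e]
  constructor <;> intro h <;> linarith

/-- **NECESSARY SIDE: a content member has `log|disc F_{a,c}| < (l/(l+40))·(a·log 5 − 40·d*₂·l)`** (`7^c ≤ 5^a`, so `Q ≤ 3a·log 5`): its
squarefree kernel is below `5^{a·l/(l+40)} ≤ √D·D^{−20/(l+40)}`, and necessarily `a·log 5 > 40·d*₂·l` (`d*₂ = 1105920`; `> 7.6·10⁹` at `l = 173`).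
[cite: MochizukiGenEll2010, Def 1.5 (iii) p.8] [claim: Mochizuki2012, status: disputed] -/
theorem log_discr_lt_of_content (hlo : 7 ^ c ≤ 5 ^ a)
    (hcont : 6 * ((1 + 20 * (dmod (Pt a c) : ℝ) / l) * ((Pt a c).logDiff + logCondAvoid (Pt a c) {2, l}))
        + 120 * (2 ^ 12 * 3 ^ 3 * 5 * (dmod (Pt a c) : ℝ) * l) < logQAvoid (Pt a c) {2, l}) :
    Real.log ((NumberField.discr (F a c)).natAbs : ℝ) <
      (l : ℝ) / ((l : ℝ) + 40) * ((a : ℝ) * Real.log 5 - 40 * (2 ^ 12 * 3 ^ 3 * 5 * 2 * (l : ℝ))) := by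
  rw [content_iff_log_discr_lt ha hc hl h11] at hcont
  have hlr : (11 : ℝ) ≤ (l : ℝ) := by exact_mod_cast h11
  have h0 : (0 : ℝ) < (l : ℝ) := by linarith
  have hl0 : (l : ℝ) ≠ 0 := h0.ne'
  have h40 : (l : ℝ) + 40 ≠ 0 := ne_of_gt (by linarith)
  have hlog5 : 0 < Real.log 5 := Real.log_pos (by norm_num)
  have hlog7 : 0 < Real.log 7 := Real.log_pos (by norm_num)
  have hcl : (c : ℝ) * Real.log 7 ≤ (a : ℝ) * Real.log 5 := by
    have h := Real.log_le_log (by positivity) (show ((7 : ℝ) ^ c) ≤ (5 : ℝ) ^ a by exact_mod_cast hlo)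
    rwa [Real.log_pow, Real.log_pow] at h
  have hden : 0 < 3 * (1 + 40 / (l : ℝ)) := by positivity
  have h1 : ((a : ℝ) * Real.log 5 + 2 * (c : ℝ) * Real.log 7 - 120 * (2 ^ 12 * 3 ^ 3 * 5 * 2 * (l : ℝ))) / (3 * (1 + 40 / (l : ℝ))) ≤
      (3 * ((a : ℝ) * Real.log 5) - 120 * (2 ^ 12 * 3 ^ 3 * 5 * 2 * (l : ℝ))) / (3 * (1 + 40 / (l : ℝ))) :=
    div_le_div_of_nonneg_right (by linarith) hden.le
  have e : (3 * ((a : ℝ) * Real.log 5) - 120 * (2 ^ 12 * 3 ^ 3 * 5 * 2 * (l : ℝ))) / (3 * (1 + 40 / (l : ℝ))) =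
      (l : ℝ) / ((l : ℝ) + 40) * ((a : ℝ) * Real.log 5 - 40 * (2 ^ 12 * 3 ^ 3 * 5 * 2 * (l : ℝ))) := by
    field_simp
    ring
  rw [e] at h1
  have : 0 < Real.log 5 + 2 * Real.log 7 := by positivity
  linarith

/-- **SUFFICIENT SIDE: `log|disc F_{a,c}| ≤ (l/(l+40))·(a·log 5 − (2/3)·l·log 5 − 40·d*₂·l) − (log 5 + 2·log 7) − 1` makes `(P_{a,c}, l)` a content
point** (`5^a ≤ 5^l·7^c`, so `Q ≥ 3a·log 5 − 2l·log 5`). Neither side is asserted to be inhabited.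
[cite: MochizukiGenEll2010, Def 1.5 (iii) p.8] [claim: Mochizuki2012, status: disputed] -/
theorem content_of_log_discr_le (hhi : 5 ^ a ≤ 5 ^ l * 7 ^ c)
    (hdisc : Real.log ((NumberField.discr (F a c)).natAbs : ℝ) ≤
      (l : ℝ) / ((l : ℝ) + 40) * ((a : ℝ) * Real.log 5 - 2 / 3 * (l : ℝ) * Real.log 5 - 40 * (2 ^ 12 * 3 ^ 3 * 5 * 2 * (l : ℝ)))
        - (Real.log 5 + 2 * Real.log 7) - 1) :
    6 * ((1 + 20 * (dmod (Pt a c) : ℝ) / l) * ((Pt a c).logDiff + logCondAvoid (Pt a c) {2, l}))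
        + 120 * (2 ^ 12 * 3 ^ 3 * 5 * (dmod (Pt a c) : ℝ) * l) < logQAvoid (Pt a c) {2, l} := by
  rw [content_iff_log_discr_lt ha hc hl h11]
  have hlr : (11 : ℝ) ≤ (l : ℝ) := by exact_mod_cast h11
  have h0 : (0 : ℝ) < (l : ℝ) := by linarith
  have hl0 : (l : ℝ) ≠ 0 := h0.ne'
  have h40 : (l : ℝ) + 40 ≠ 0 := ne_of_gt (by linarith)
  have hlog5 : 0 < Real.log 5 := Real.log_pos (by norm_num)
  have hlog7 : 0 < Real.log 7 := Real.log_pos (by norm_num)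
  have hcl : (a : ℝ) * Real.log 5 ≤ (l : ℝ) * Real.log 5 + (c : ℝ) * Real.log 7 := by
    have h := Real.log_le_log (by positivity) (show ((5 : ℝ) ^ a) ≤ (5 : ℝ) ^ l * (7 : ℝ) ^ c by exact_mod_cast hhi)
    rw [Real.log_mul (by positivity) (by positivity), Real.log_pow, Real.log_pow, Real.log_pow] at h
    linarith
  have hden : 0 < 3 * (1 + 40 / (l : ℝ)) := by positivity
  have h1 : (3 * ((a : ℝ) * Real.log 5) - 2 * (l : ℝ) * Real.log 5 - 120 * (2 ^ 12 * 3 ^ 3 * 5 * 2 * (l : ℝ))) / (3 * (1 + 40 / (l : ℝ))) ≤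
      ((a : ℝ) * Real.log 5 + 2 * (c : ℝ) * Real.log 7 - 120 * (2 ^ 12 * 3 ^ 3 * 5 * 2 * (l : ℝ))) / (3 * (1 + 40 / (l : ℝ))) :=
    div_le_div_of_nonneg_right (by linarith) hden.le
  have e : (3 * ((a : ℝ) * Real.log 5) - 2 * (l : ℝ) * Real.log 5 - 120 * (2 ^ 12 * 3 ^ 3 * 5 * 2 * (l : ℝ))) / (3 * (1 + 40 / (l : ℝ))) =
      (l : ℝ) / ((l : ℝ) + 40) * ((a : ℝ) * Real.log 5 - 2 / 3 * (l : ℝ) * Real.log 5 - 40 * (2 ^ 12 * 3 ^ 3 * 5 * 2 * (l : ℝ))) := by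
    field_simp
    ring
  rw [e] at h1
  linarith

end Content

end SUnitFamily

namespace Conditional

/-- **`hregC` (certificate of record K, C-R47) IS FALSE IF THE S-UNIT FAMILY HAS CONTENT MEMBERS OF UNBOUNDED HEIGHT.** For a prime `l ≥ 173`:
if for every `N` there are `a ≥ N`, `c` with `l ∤ a`, `l ∤ c`, `7^c ≤ 5^a ≤ 5^l·7^c` and `(P_{a,c}, l)` on the display-content locus (antecedent
VERBATIM), then `hregC` (binder text VERBATIM as in p459802 / p460293) fails — `Conditional.not_hregCut_of_sUnitFamily` with `X` = the content
guard. The antecedent (a powerful-`D` condition, `SUnitFamily.content_iff_log_discr_lt`) is NOT asserted.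
[cite: Mochizuki2012, IUTchIV Thm. 1.10 p. 22–23; proof Steps (v)-(viii) p. 27–31] [claim: Mochizuki2012, status: disputed] -/
theorem not_hregC_of_sUnitFamily_content {l : ℕ} (hl : l.Prime) (h173 : 173 ≤ l)
    (H : ∀ N : ℕ, ∃ a c : ℕ, N ≤ a ∧ ¬ l ∣ a ∧ ¬ l ∣ c ∧ 7 ^ c ≤ 5 ^ a ∧ 5 ^ a ≤ 5 ^ l * 7 ^ c ∧
      6 * ((1 + 20 * (Cor22.dmod (SUnitFamily.Pt a c) : ℝ) / l)
            * ((SUnitFamily.Pt a c).logDiff + Cor22.logCondAvoid (SUnitFamily.Pt a c) {2, l}))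
          + 120 * (2 ^ 12 * 3 ^ 3 * 5 * (Cor22.dmod (SUnitFamily.Pt a c) : ℝ) * l) < Cor22.logQAvoid (SUnitFamily.Pt a c) {2, l}) :
    ¬ (∀ P : NFPoint, P ∈ UP → ∀ l : ℕ, l.Prime → 5 ≤ l →
      Cor22.AdmitsCore P → Cor22.CondP2 P l → Cor22.CondP5 P l → Cor22.CondP6 P l →
      6 * ((1 + 20 * (Cor22.dmod P : ℝ) / l) * (P.logDiff + Cor22.logCondAvoid P {2, l}))
          + 120 * (2 ^ 12 * 3 ^ 3 * 5 * (Cor22.dmod P : ℝ) * l) < Cor22.logQAvoid P {2, l} →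
      ∀ T : Cor22.ThetaVolumeDatumAt P l,
        (letI := T.instFieldF; letI := T.instNumberFieldF; letI := T.instAlgebraF; letI := T.instFieldK
         letI := T.instNumberFieldK; letI := T.instAlgebraK; letI := T.instFieldFbar; letI := T.instAlgebraFbar
         letI := T.instAlgebraKFbar; letI := T.instIsElliptic
         ¬ (∀ p ∈ T.I.supportPrimes, ∀ v w : placesOver (fieldOfModuli T.E) p,
            (Summit.ABC.IUTFork.DHData.ofInput T.I).logQloc p v = (Summit.ABC.IUTFork.DHData.ofInput T.I).logQloc p w)) →
        T.HullEstimateOf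
          (((l : ℝ) + 1) / 4 *
            ((1 + 12 * (Cor22.dmod P : ℝ) / l) * (P.logDiff + Cor22.logCondAvoid P {2, l})
              + 2 * Real.log l + 52
              + 20 / 3 * Real.log (((2 ^ 12 * 3 ^ 3 * 5 * Cor22.dmod P : ℕ) : ℝ) * (l : ℝ))
                * (Nat.primeCounting (2 ^ 12 * 3 ^ 3 * 5 * Cor22.dmod P * l) : ℝ)))) :=
  not_hregCut_of_sUnitFamily
    (X := fun P l => 6 * ((1 + 20 * (Cor22.dmod P : ℝ) / l) * (P.logDiff + Cor22.logCondAvoid P {2, l}))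
      + 120 * (2 ^ 12 * 3 ^ 3 * 5 * (Cor22.dmod P : ℝ) * l) < Cor22.logQAvoid P {2, l}) hl h173 H

/-- **`hregC` IS FALSE IF `5^{2a} + 4·7^{2c}` IS POWERFUL (content-grade) INFINITELY OFTEN.** For a prime `l ≥ 173`: members with `a` unbounded
(`l ∤ a, c`, `7^c ≤ 5^a ≤ 5^l·7^c`) and `log|disc ℚ(√(5^{2a}+4·7^{2c}))| ≤ (l/(l+40))·(a·log 5 − (2/3)·l·log 5 − 40·d*₂·l) − (log 5 + 2 log 7) − 1`
kill `hregC` (`SUnitFamily.content_of_log_discr_le`). Antecedent NOT asserted (it contradicts abc over `ℚ` for these triples).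
[cite: MochizukiGenEll2010, Def 1.5 (iii) p.8] [claim: Mochizuki2012, status: disputed] -/
theorem not_hregC_of_sUnitFamily_powerful {l : ℕ} (hl : l.Prime) (h173 : 173 ≤ l)
    (H : ∀ N : ℕ, ∃ a c : ℕ, N ≤ a ∧ ¬ l ∣ a ∧ ¬ l ∣ c ∧ 7 ^ c ≤ 5 ^ a ∧ 5 ^ a ≤ 5 ^ l * 7 ^ c ∧
      Real.log ((NumberField.discr (SUnitFamily.F a c)).natAbs : ℝ) ≤
        (l : ℝ) / ((l : ℝ) + 40) * ((a : ℝ) * Real.log 5 - 2 / 3 * (l : ℝ) * Real.log 5 - 40 * (2 ^ 12 * 3 ^ 3 * 5 * 2 * (l : ℝ)))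
          - (Real.log 5 + 2 * Real.log 7) - 1) :
    ¬ (∀ P : NFPoint, P ∈ UP → ∀ l : ℕ, l.Prime → 5 ≤ l →
      Cor22.AdmitsCore P → Cor22.CondP2 P l → Cor22.CondP5 P l → Cor22.CondP6 P l →
      6 * ((1 + 20 * (Cor22.dmod P : ℝ) / l) * (P.logDiff + Cor22.logCondAvoid P {2, l}))
          + 120 * (2 ^ 12 * 3 ^ 3 * 5 * (Cor22.dmod P : ℝ) * l) < Cor22.logQAvoid P {2, l} →
      ∀ T : Cor22.ThetaVolumeDatumAt P l,
        (letI := T.instFieldF; letI := T.instNumberFieldF; letI := T.instAlgebraF; letI := T.instFieldK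
         letI := T.instNumberFieldK; letI := T.instAlgebraK; letI := T.instFieldFbar; letI := T.instAlgebraFbar
         letI := T.instAlgebraKFbar; letI := T.instIsElliptic
         ¬ (∀ p ∈ T.I.supportPrimes, ∀ v w : placesOver (fieldOfModuli T.E) p,
            (Summit.ABC.IUTFork.DHData.ofInput T.I).logQloc p v = (Summit.ABC.IUTFork.DHData.ofInput T.I).logQloc p w)) →
        T.HullEstimateOf
          (((l : ℝ) + 1) / 4 *
            ((1 + 12 * (Cor22.dmod P : ℝ) / l) * (P.logDiff + Cor22.logCondAvoid P {2, l})
              + 2 * Real.log l + 52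
              + 20 / 3 * Real.log (((2 ^ 12 * 3 ^ 3 * 5 * Cor22.dmod P : ℕ) : ℝ) * (l : ℝ))
                * (Nat.primeCounting (2 ^ 12 * 3 ^ 3 * 5 * Cor22.dmod P * l) : ℝ)))) := by
  refine not_hregC_of_sUnitFamily_content hl h173 fun N => ?_
  obtain ⟨a, c, hNa, hla, hlc, hlo, hhi, hdisc⟩ := H (N + l + 1)
  have ha1 : 1 ≤ a := by omega
  have hc1 : 1 ≤ c := by
    by_contra h0
    have hc0 : c = 0 := by omega
    rw [hc0, pow_zero, mul_one] at hhi
    have := (Nat.pow_le_pow_iff_right (by norm_num : 1 < 5)).mp hhi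
    omega
  exact ⟨a, c, by omega, hla, hlc, hlo, hhi, SUnitFamily.content_of_log_discr_le ha1 hc1 hl (by omega) hhi hdisc⟩

/-- **`hregC` IMPLIES THAT NO LARGE MEMBER OF THE S-UNIT FAMILY IS A CONTENT POINT** (prime `l ≥ 173`; contrapositive of
`not_hregC_of_sUnitFamily_content`): the record's cone binder contains, for this explicit infinite family of admissible `d_mod = 2` points, the
Szpiro-type inequality «`log q^{∤{2,l}} ≤ 6(1 + 20·d_mod/l)(log-diff + log-cond) + 120·d*_mod·l`» beyond a height. Nothing asserted about either side.
[cite: Mochizuki2012, IUTchIV Thm. 1.10 p. 22–23] [claim: Mochizuki2012, status: disputed] -/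
theorem contentFree_eventually_of_hregC {l : ℕ} (hl : l.Prime) (h173 : 173 ≤ l)
    (hregC : ∀ P : NFPoint, P ∈ UP → ∀ l : ℕ, l.Prime → 5 ≤ l →
      Cor22.AdmitsCore P → Cor22.CondP2 P l → Cor22.CondP5 P l → Cor22.CondP6 P l →
      6 * ((1 + 20 * (Cor22.dmod P : ℝ) / l) * (P.logDiff + Cor22.logCondAvoid P {2, l}))
          + 120 * (2 ^ 12 * 3 ^ 3 * 5 * (Cor22.dmod P : ℝ) * l) < Cor22.logQAvoid P {2, l} →
      ∀ T : Cor22.ThetaVolumeDatumAt P l,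
        (letI := T.instFieldF; letI := T.instNumberFieldF; letI := T.instAlgebraF; letI := T.instFieldK
         letI := T.instNumberFieldK; letI := T.instAlgebraK; letI := T.instFieldFbar; letI := T.instAlgebraFbar
         letI := T.instAlgebraKFbar; letI := T.instIsElliptic
         ¬ (∀ p ∈ T.I.supportPrimes, ∀ v w : placesOver (fieldOfModuli T.E) p,
            (Summit.ABC.IUTFork.DHData.ofInput T.I).logQloc p v = (Summit.ABC.IUTFork.DHData.ofInput T.I).logQloc p w)) →
        T.HullEstimateOf
          (((l : ℝ) + 1) / 4 *
            ((1 + 12 * (Cor22.dmod P : ℝ) / l) * (P.logDiff + Cor22.logCondAvoid P {2, l})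
              + 2 * Real.log l + 52
              + 20 / 3 * Real.log (((2 ^ 12 * 3 ^ 3 * 5 * Cor22.dmod P : ℕ) : ℝ) * (l : ℝ))
                * (Nat.primeCounting (2 ^ 12 * 3 ^ 3 * 5 * Cor22.dmod P * l) : ℝ)))) :
    ∃ N : ℕ, ∀ a c : ℕ, N ≤ a → ¬ l ∣ a → ¬ l ∣ c → 7 ^ c ≤ 5 ^ a → 5 ^ a ≤ 5 ^ l * 7 ^ c →
      ¬ (6 * ((1 + 20 * (Cor22.dmod (SUnitFamily.Pt a c) : ℝ) / l)
            * ((SUnitFamily.Pt a c).logDiff + Cor22.logCondAvoid (SUnitFamily.Pt a c) {2, l}))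
          + 120 * (2 ^ 12 * 3 ^ 3 * 5 * (Cor22.dmod (SUnitFamily.Pt a c) : ℝ) * l) < Cor22.logQAvoid (SUnitFamily.Pt a c) {2, l}) := by
  by_contra hne
  push Not at hne
  exact not_hregC_of_sUnitFamily_content hl h173 hne hregC

/-- **`hregC` IMPLIES AN abc-TYPE LOWER BOUND FOR `disc ℚ(√(5^{2a} + 4·7^{2c}))` (content grade).** For a prime `l ≥ 173`: if `hregC` holds, then
for all large `a` (`l ∤ a, c`, `7^c ≤ 5^a ≤ 5^l·7^c`):
`log|disc ℚ(√(5^{2a}+4·7^{2c}))| > (l/(l+40))·(a·log 5 − (2/3)·l·log 5 − 40·d*₂·l) − (log 5 + 2·log 7) − 1` — the squarefree kernel of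
`D = 5^{2a} + 4·7^{2c}` eventually exceeds `≈ D^{½·l/(l+40)}·e^{−40·d*₂·l}`. Contrapositive of `not_hregC_of_sUnitFamily_powerful`; the tree
can neither prove nor refute the conclusion. [cite: MochizukiGenEll2010, Def 1.5 (iii) p.8] [claim: Mochizuki2012, status: disputed] -/
theorem lt_log_discr_eventually_of_hregC {l : ℕ} (hl : l.Prime) (h173 : 173 ≤ l)
    (hregC : ∀ P : NFPoint, P ∈ UP → ∀ l : ℕ, l.Prime → 5 ≤ l →
      Cor22.AdmitsCore P → Cor22.CondP2 P l → Cor22.CondP5 P l → Cor22.CondP6 P l →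
      6 * ((1 + 20 * (Cor22.dmod P : ℝ) / l) * (P.logDiff + Cor22.logCondAvoid P {2, l}))
          + 120 * (2 ^ 12 * 3 ^ 3 * 5 * (Cor22.dmod P : ℝ) * l) < Cor22.logQAvoid P {2, l} →
      ∀ T : Cor22.ThetaVolumeDatumAt P l,
        (letI := T.instFieldF; letI := T.instNumberFieldF; letI := T.instAlgebraF; letI := T.instFieldK
         letI := T.instNumberFieldK; letI := T.instAlgebraK; letI := T.instFieldFbar; letI := T.instAlgebraFbar
         letI := T.instAlgebraKFbar; letI := T.instIsElliptic
         ¬ (∀ p ∈ T.I.supportPrimes, ∀ v w : placesOver (fieldOfModuli T.E) p,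
            (Summit.ABC.IUTFork.DHData.ofInput T.I).logQloc p v = (Summit.ABC.IUTFork.DHData.ofInput T.I).logQloc p w)) →
        T.HullEstimateOf
          (((l : ℝ) + 1) / 4 *
            ((1 + 12 * (Cor22.dmod P : ℝ) / l) * (P.logDiff + Cor22.logCondAvoid P {2, l})
              + 2 * Real.log l + 52
              + 20 / 3 * Real.log (((2 ^ 12 * 3 ^ 3 * 5 * Cor22.dmod P : ℕ) : ℝ) * (l : ℝ))
                * (Nat.primeCounting (2 ^ 12 * 3 ^ 3 * 5 * Cor22.dmod P * l) : ℝ)))) :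
    ∃ N : ℕ, ∀ a c : ℕ, N ≤ a → ¬ l ∣ a → ¬ l ∣ c → 7 ^ c ≤ 5 ^ a → 5 ^ a ≤ 5 ^ l * 7 ^ c →
      (l : ℝ) / ((l : ℝ) + 40) * ((a : ℝ) * Real.log 5 - 2 / 3 * (l : ℝ) * Real.log 5 - 40 * (2 ^ 12 * 3 ^ 3 * 5 * 2 * (l : ℝ)))
          - (Real.log 5 + 2 * Real.log 7) - 1 <
        Real.log ((NumberField.discr (SUnitFamily.F a c)).natAbs : ℝ) := by
  by_contra hne
  push Not at hne
  exact not_hregC_of_sUnitFamily_powerful hl h173 hne hregC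

end Conditional

end Summit.ABC.IUTFork

end
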